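import Summits.QuantumFields.BalabanUV.T4Continuum.Support.ShellMeasureRootCompositionPush

/-!
# `T4Continuum.ShellMeasureRootCompositionPushCubes` — the READING (R) and the [dict] PUSH of END-I made kernel AT
# LEVEL 0 for the FULL CUBE PARTITION: finitely many small-field slots, terms indexed by the SMALL-FIELD REGION, END-I's
# per-run binders `sh_nonneg ∕ sh_le ∕ cover ∕ piece_le ∕ total_ge` PROVED (`M := 1`, every slot's realized measure =
# the positive integral itself)
# (cell `pub-balaban`, sub-cell `t4`, spine estimate NE7c (node U5b); NE7c ROUND-2 crew `t4-ne7c-formalise-*`, unit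
# `b2b-balaban-t4-ne7c-formalise-leaf-06`, row S12 part 2 (offered as S17, journal l.6202; the owner t4-ne7c-p1 may
# renumber); ADDITIVE — imports row S12's `ShellMeasureRootCompositionPush` (p208279) only; 0 `def … : Prop`, 0 sorry,
# 0 cite tags)

HONEST FRAMING.  Finite four-torus programme, rung (B)+1 only — NOT infinite volume, NOT a mass gap, NOT the Clay
problem, NOT summit progress.  NE7c = `T4IndicatorShell.ShellWeightBound` is NOT PRINTED in [Balaban 1983–89] and NOT
PROVED; END-I (`ShellMeasureRootComposition.shellWeightBound_of_slotAC`) is the COMPOSITION «NE7c ⇐ the named binders»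
(trigger c3).  Row S12 inhabited END-I's PER-RUN binder shapes for ONE slot; this file does it for the level-0 expansion
of B14 (2.17)–(2.18) TYPE with a FINITE FAMILY of small-field slots `C K` (the cubes of the level-0 partition at cutoff
`K`) and terms INDEXED BY THE SMALL-FIELD REGION `Ω₀ ⊆ C K` (TYPE only, nothing transcribed):
`∏_{□∈C K} (χ_□ + ζ_□) = Σ_{Ω₀ ⊆ C K} ∏_{□∈Ω₀} χ_□ ∏_{□∈C K∖Ω₀} ζ_□` inside a positive integral.  INSTANTIABILITY CHECK,
design-neutral, [folklore]: no (M1), no window, no count, no rate is proved or used; the plug `levelLedger_levelZero_cubes`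
leaves exactly (M1)₀ PER SLOT displayed.  HONEST DEPENDENCY (cell): continuum YM on T⁴ ⇐ BetaPertH ∧ nine spine estimates
(0/9 proved); BetaPertH ⇐ (D1) ∧ (D4) ∧ CAP+tail; G-an2-4 gates asym, D1 and NE2/3/4.

THE INSTANCE (run A; run B = the same theorems with the tested variables exchanged).  Slots `σ`, cubes present at cutoff
`K` a finset `C K`; per slot the tested variables `u^A K t s, u^B K t s : Ω K → ℝ` of the two runs on the common space;
ONE threshold `θ₀ = θ 0`, width `ρ₀ = ρ 0`; the positive integral = a finite measure `μ K t` (S12 §4: the `R·dν` form).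
TERM of the region `Ω₀ ⊆ C K`: `regionDensity (C K) u^A θ₀ Ω₀ = ∏_{s∈Ω₀} χ_θ₀(u^A_s) · ∏_{s∈C K∖Ω₀} ζ_θ₀(u^A_s)`, weight
`A K t Ω₀ = ∫ regionDensity dμ`; DECOMPOSITION OF UNITY `Σ_{Ω₀ ⊆ C K} regionDensity Ω₀ = 1` (Mathlib `Finset.prod_add`).
DESIGN (i) refines the SMALL slots of a term against the other run (END-I's slot shapes weigh the shell BELOW each
threshold; the large-field factors `ζ(u^A_s)` stay unrefined, cf. S12): SHELL PART `sh K t Ω₀ = ∫ regionDensity^A Ω₀ ·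
(1 − ∏_{s∈Ω₀} χ_θ₀(u^B_s)) dμ` (`A − sh` = the CORE `∫ ∏_{Ω₀} χ^Aχ^B · ∏ ζ^A`, `core_eq`); PIECE of slot `s` in term
`Ω₀`: `[s ∈ Ω₀] · ∫ regionDensity^A Ω₀ · (1 − χ_θ₀(u^B_s)) dμ`.  REALIZED measure of EVERY slot = `μ K t` itself (own
indicator removed, the other slots' partition of unity summed: `Σ_{Ω₀ ∋ s} regionDensity Ω₀ = χ(u_s)`,
`sum_regionDensity_mem`), tested variable `u^A K t s`, `M = 1`, every slot at level `0`.

WHAT IS PROVED ([folklore]).  §1 `regionDensity`∕`regionWeight`∕`regionShell`∕`regionPiece`, bounds, measurability,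
integrability; `sum_regionDensity`, `smallInd_mul_regionDensity`, `sum_regionDensity_mem`, `one_sub_prod_le_sum` (union
bound `1 − ∏ q ≤ Σ (1 − q)` on `[0,1]`), `sum_regionWeight_eq` (`Σ A = μ(univ)`), `core_eq`, `regionShell_le_sum_piece`
(cover), `sum_regionPiece_eq` (`Σ_{Ω₀} piece s Ω₀ = ∫ χ(u^A_s)(1 − χ(u^B_s)) dμ`), `sum_regionPiece_le` (⇒ `≤ 1·μ{θ(1−ρ) ≤
u^A_s < θ}` under a.e. `ρθ`-closeness of slot `s`: road P2's `integral_mismatch_le`).  §2 END-I's PER-RUN BINDERS in the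
LITERAL shapes of `levelLedger_of_slotAC` (`T K = (C K).powerset`, `S K = C K`, `lvl = 0`, `M = 1`): `sh_nonneg`, `sh_le`,
`cover`, `M_nonneg`, `piece_le`, `total_ge` (equality).  §3 `levelLedger_levelZero_cubes` (⇐ measurability, a.e.
closeness per slot, signs, THE WALL (M1)₀ PER SLOT), `omega_levelZero_cubes` (`ω K = #(C K)·D₀ρ₀` — the level-0 slot
COUNT times one summand; bounding the count inside the live window is (W1)∕row S9, NOT done here).

WHAT THIS DOES NOT DO.  No (M1)₀ (rows S1∕S2), no window∕count (S9), no rate (U1b), no live level (END-II); terms with a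
large-field cube keep unrefined `ζ^A` factors in their cores — for `T4IndicatorShell.good_ref` they must sit in NE7b's
bad class (NE7b's datum, not proved); all level-0 slots at every `K` are NOT a `LiveWindow` for `K > N₁`.  NE7c NOT
proved; 0/9 spine.
-/

noncomputable section

open MeasureTheory Finset Filter

namespace Summit.QuantumFields.BalabanUV.T4Continuum.ShellMeasureRootCompositionPushCubes

open Literature.MathematicalPhysics.QuantumFieldTheory.Balaban1983to89
open T4IndicatorShell (smallInd largeInd smallInd_nonneg smallInd_le_one largeInd_nonneg largeInd_le_one
  smallInd_add_largeInd)
open T4ShellMeasure (SlotAntiConcentration)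
open T4ShellMeasureLevels (LevelLedger)
open ShellMeasureWindowLiaison (integral_mismatch_le mismatch_nonneg)
open ShellMeasureRootComposition (levelLedger_of_slotAC)
open ShellMeasureRootCompositionPush (measurable_smallInd measurable_largeInd integrable_smallInd)

/-! ## §1 The cube partition at level 0: regions, densities, weights, shell parts, pieces -/

section Objects

variable {Ω : Type*} {σ : Type*} [DecidableEq σ]

/-- `χ_θ(u)² = χ_θ(u)` (a `{0,1}`-valued indicator). [folklore] -/
theorem smallInd_mul_self (u θ : ℝ) : smallInd u θ * smallInd u θ = smallInd u θ := by
  unfold T4IndicatorShell.smallInd; split_ifs <;> norm_num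

/-- `χ_θ(u)·ζ_θ(u) = 0` (the two indicators of one slot are disjoint). [folklore] -/
theorem smallInd_mul_largeInd (u θ : ℝ) : smallInd u θ * largeInd u θ = 0 := by
  unfold T4IndicatorShell.smallInd T4IndicatorShell.largeInd
  by_cases h : u < θ
  · simp [h, not_le.2 h]
  · simp [h]

/-- THE TERM DENSITY OF THE SMALL-FIELD REGION `Ω₀ ⊆ C`: `∏_{s∈Ω₀} χ_θ(u_s(ω)) · ∏_{s∈C∖Ω₀} ζ_θ(u_s(ω))` — the
cubes in `Ω₀` are small-field, the other cubes of the partition `C` large-field (B14 (2.17)–(2.18) TYPE at level 0).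
[folklore] -/
def regionDensity (C : Finset σ) (u : σ → Ω → ℝ) (θ : ℝ) (O : Finset σ) (ω : Ω) : ℝ :=
  (∏ s ∈ O, smallInd (u s ω) θ) * ∏ s ∈ C \ O, largeInd (u s ω) θ

/-- term densities are nonnegative. [folklore] -/
theorem regionDensity_nonneg (C : Finset σ) (u : σ → Ω → ℝ) (θ : ℝ) (O : Finset σ) (ω : Ω) :
    0 ≤ regionDensity C u θ O ω :=
  mul_nonneg (prod_nonneg fun _ _ => smallInd_nonneg _ _) (prod_nonneg fun _ _ => largeInd_nonneg _ _)

/-- term densities are at most `1`. [folklore] -/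
theorem regionDensity_le_one (C : Finset σ) (u : σ → Ω → ℝ) (θ : ℝ) (O : Finset σ) (ω : Ω) :
    regionDensity C u θ O ω ≤ 1 := by
  unfold regionDensity
  calc (∏ s ∈ O, smallInd (u s ω) θ) * ∏ s ∈ C \ O, largeInd (u s ω) θ ≤ 1 * 1 :=
        mul_le_mul (prod_le_one (fun _ _ => smallInd_nonneg _ _) fun _ _ => smallInd_le_one _ _)
          (prod_le_one (fun _ _ => largeInd_nonneg _ _) fun _ _ => largeInd_le_one _ _)
          (prod_nonneg fun _ _ => largeInd_nonneg _ _) zero_le_one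
    _ = 1 := one_mul 1

/-- **THE DECOMPOSITION OF UNITY OF THE CUBE PARTITION**: `Σ_{Ω₀ ⊆ C} ∏_{Ω₀} χ ∏_{C∖Ω₀} ζ = ∏_{s∈C} (χ_s + ζ_s) = 1`
(Mathlib `Finset.prod_add`). [folklore] -/
theorem sum_regionDensity (C : Finset σ) (u : σ → Ω → ℝ) (θ : ℝ) (ω : Ω) :
    ∑ O ∈ C.powerset, regionDensity C u θ O ω = 1 := by
  have h := Finset.prod_add (s := C) (f := fun s => smallInd (u s ω) θ) (g := fun s => largeInd (u s ω) θ)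
  simp only [smallInd_add_largeInd, prod_const_one] at h
  unfold regionDensity
  exact h.symm

/-- **ONE SLOT'S INDICATOR AGAINST A TERM**: for a cube `s` of the partition, `χ_θ(u_s) · density_{Ω₀} = density_{Ω₀}`
if `s ∈ Ω₀` (the factor is already there, `χ² = χ`) and `= 0` if `s ∉ Ω₀` (`χ·ζ = 0`). [folklore] -/
theorem smallInd_mul_regionDensity (C : Finset σ) (u : σ → Ω → ℝ) (θ : ℝ) (O : Finset σ) {s : σ} (hs : s ∈ C)
    (ω : Ω) :
    smallInd (u s ω) θ * regionDensity C u θ O ω = if s ∈ O then regionDensity C u θ O ω else 0 := by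
  unfold regionDensity
  by_cases hsO : s ∈ O
  · rw [if_pos hsO, ← Finset.mul_prod_erase O (fun s => smallInd (u s ω) θ) hsO, ← mul_assoc, ← mul_assoc,
      smallInd_mul_self]
  · rw [if_neg hsO]
    have hs' : s ∈ C \ O := Finset.mem_sdiff.2 ⟨hs, hsO⟩
    rw [← Finset.mul_prod_erase (C \ O) (fun s => largeInd (u s ω) θ) hs']
    calc smallInd (u s ω) θ * ((∏ s ∈ O, smallInd (u s ω) θ) *
          (largeInd (u s ω) θ * ∏ x ∈ (C \ O).erase s, largeInd (u x ω) θ))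
        = (smallInd (u s ω) θ * largeInd (u s ω) θ) *
          ((∏ s ∈ O, smallInd (u s ω) θ) * ∏ x ∈ (C \ O).erase s, largeInd (u x ω) θ) := by ring
      _ = 0 := by rw [smallInd_mul_largeInd, zero_mul]

/-- **«THE SLOT'S OWN INDICATOR REMOVED»**: summing the terms containing the small cube `s` gives back the slot's own
indicator, `Σ_{Ω₀ ⊆ C, s ∈ Ω₀} density_{Ω₀} = χ_θ(u_s)` — so the realized measure of slot `s` (the positive integral
with `χ_s` removed) is the whole positive integral `μ`. [folklore] -/
theorem sum_regionDensity_mem (C : Finset σ) (u : σ → Ω → ℝ) (θ : ℝ) {s : σ} (hs : s ∈ C) (ω : Ω) :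
    ∑ O ∈ C.powerset, (if s ∈ O then regionDensity C u θ O ω else 0) = smallInd (u s ω) θ := by
  rw [← Finset.sum_congr rfl fun O _ => smallInd_mul_regionDensity C u θ O hs ω, ← Finset.mul_sum,
    sum_regionDensity, mul_one]

/-- the UNION BOUND for indicators in `[0,1]`: `1 − ∏_{s∈Ω₀} q_s ≤ Σ_{s∈Ω₀} (1 − q_s)`. [folklore] -/
theorem one_sub_prod_le_sum (O : Finset σ) {q : σ → ℝ} (hq0 : ∀ s, 0 ≤ q s) (hq1 : ∀ s, q s ≤ 1) :
    1 - ∏ s ∈ O, q s ≤ ∑ s ∈ O, (1 - q s) := by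
  induction O using Finset.induction_on with
  | empty => simp
  | @insert a O ha ih =>
    rw [Finset.prod_insert ha, Finset.sum_insert ha]
    have hP0 : 0 ≤ ∏ s ∈ O, q s := prod_nonneg fun s _ => hq0 s
    have hP1 : ∏ s ∈ O, q s ≤ 1 := prod_le_one (fun s _ => hq0 s) fun s _ => hq1 s
    nlinarith [hq0 a, hq1 a]

omit [DecidableEq σ] in
/-- the `∏ χ^B` factor lies in `[0,1]`. [folklore] -/
theorem prod_smallInd_mem (O : Finset σ) (uB : σ → Ω → ℝ) (θ : ℝ) (ω : Ω) :
    0 ≤ ∏ s ∈ O, smallInd (uB s ω) θ ∧ ∏ s ∈ O, smallInd (uB s ω) θ ≤ 1 :=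
  ⟨prod_nonneg fun _ _ => smallInd_nonneg _ _, prod_le_one (fun _ _ => smallInd_nonneg _ _) fun _ _ =>
    smallInd_le_one _ _⟩

/-- **(R) `cover` POINTWISE**: the mismatch of a term splits over its small slots by the union bound,
`density^A · (1 − ∏_{Ω₀} χ^B) ≤ Σ_{s∈Ω₀} density^A · (1 − χ^B_s)`. [folklore] -/
theorem regionDensity_mul_one_sub_prod_le (C : Finset σ) (uA uB : σ → Ω → ℝ) (θ : ℝ) (O : Finset σ) (ω : Ω) :
    regionDensity C uA θ O ω * (1 - ∏ s ∈ O, smallInd (uB s ω) θ) ≤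
      ∑ s ∈ O, regionDensity C uA θ O ω * (1 - smallInd (uB s ω) θ) := by
  rw [← Finset.mul_sum]
  exact mul_le_mul_of_nonneg_left (one_sub_prod_le_sum O (fun s => smallInd_nonneg _ _) fun s =>
    smallInd_le_one _ _) (regionDensity_nonneg C uA θ O ω)

variable [MeasurableSpace Ω]

/-- term densities are measurable along measurable tested variables. [folklore] -/
theorem measurable_regionDensity (C : Finset σ) {u : σ → Ω → ℝ} (hu : ∀ s, Measurable (u s)) (θ : ℝ)
    (O : Finset σ) : Measurable (regionDensity C u θ O) := by
  unfold regionDensity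
  exact (Finset.measurable_prod _ fun s _ => measurable_smallInd (hu s) θ).mul
    (Finset.measurable_prod _ fun s _ => measurable_largeInd (hu s) θ)

/-- … and integrable against a finite measure. [folklore] -/
theorem integrable_regionDensity (μ : Measure Ω) [IsFiniteMeasure μ] (C : Finset σ) {u : σ → Ω → ℝ}
    (hu : ∀ s, Measurable (u s)) (θ : ℝ) (O : Finset σ) : Integrable (regionDensity C u θ O) μ :=
  Integrable.mono' (integrable_const (1 : ℝ)) (measurable_regionDensity C hu θ O).aestronglyMeasurable
    (Eventually.of_forall fun ω => by
      rw [Real.norm_eq_abs, abs_of_nonneg (regionDensity_nonneg C u θ O ω)]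
      exact regionDensity_le_one C u θ O ω)

/-- THE WEIGHT OF THE TERM `Ω₀`: `A_{Ω₀} = ∫ regionDensity_{Ω₀} dμ`. [folklore] -/
def regionWeight (C : Finset σ) (μ : Measure Ω) (u : σ → Ω → ℝ) (θ : ℝ) (O : Finset σ) : ℝ :=
  ∫ ω, regionDensity C u θ O ω ∂μ

/-- THE SHELL PART OF THE TERM `Ω₀` (design (i), small slots refined against the other run):
`sh_{Ω₀} = ∫ regionDensity^A_{Ω₀} · (1 − ∏_{s∈Ω₀} χ_θ(u^B_s)) dμ`. [folklore] -/
def regionShell (C : Finset σ) (μ : Measure Ω) (uA uB : σ → Ω → ℝ) (θ : ℝ) (O : Finset σ) : ℝ :=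
  ∫ ω, regionDensity C uA θ O ω * (1 - ∏ s ∈ O, smallInd (uB s ω) θ) ∂μ

/-- THE PIECE OF SLOT `s` IN THE TERM `Ω₀`: `[s ∈ Ω₀] · ∫ regionDensity^A_{Ω₀} · (1 − χ_θ(u^B_s)) dμ`. [folklore] -/
def regionPiece (C : Finset σ) (μ : Measure Ω) (uA uB : σ → Ω → ℝ) (θ : ℝ) (s : σ) (O : Finset σ) : ℝ :=
  if s ∈ O then ∫ ω, regionDensity C uA θ O ω * (1 - smallInd (uB s ω) θ) ∂μ else 0

/-- shell parts are nonnegative. [folklore] -/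
theorem regionShell_nonneg (C : Finset σ) (μ : Measure Ω) (uA uB : σ → Ω → ℝ) (θ : ℝ) (O : Finset σ) :
    0 ≤ regionShell C μ uA uB θ O :=
  integral_nonneg fun ω => mul_nonneg (regionDensity_nonneg C uA θ O ω)
    (sub_nonneg.2 (prod_smallInd_mem O uB θ ω).2)

/-- **THE SHELL PART NEVER EXCEEDS THE TERM** (`0 ≤ 1 − ∏ χ^B ≤ 1`). [folklore] -/
theorem regionShell_le_regionWeight (C : Finset σ) (μ : Measure Ω) [IsFiniteMeasure μ] {uA : σ → Ω → ℝ}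
    (huA : ∀ s, Measurable (uA s)) (uB : σ → Ω → ℝ) (θ : ℝ) (O : Finset σ) :
    regionShell C μ uA uB θ O ≤ regionWeight C μ uA θ O := by
  unfold regionShell regionWeight
  refine integral_mono_of_nonneg (Eventually.of_forall fun ω => mul_nonneg (regionDensity_nonneg C uA θ O ω)
    (sub_nonneg.2 (prod_smallInd_mem O uB θ ω).2)) (integrable_regionDensity μ C huA θ O)
    (Eventually.of_forall fun ω => ?_)
  calc regionDensity C uA θ O ω * (1 - ∏ s ∈ O, smallInd (uB s ω) θ) ≤ regionDensity C uA θ O ω * 1 :=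
        mul_le_mul_of_nonneg_left (sub_le_self _ (prod_smallInd_mem O uB θ ω).1) (regionDensity_nonneg C uA θ O ω)
    _ = regionDensity C uA θ O ω := mul_one _

/-- **THE PARTITION OF UNITY INTEGRATES TO THE TOTAL MASS**: `Σ_{Ω₀ ⊆ C} A_{Ω₀} = μ(univ)`. [folklore] -/
theorem sum_regionWeight_eq (C : Finset σ) (μ : Measure Ω) [IsFiniteMeasure μ] {u : σ → Ω → ℝ}
    (hu : ∀ s, Measurable (u s)) (θ : ℝ) :
    ∑ O ∈ C.powerset, regionWeight C μ u θ O = (μ Set.univ).toReal := by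
  unfold regionWeight
  rw [← integral_finsetSum _ fun O _ => integrable_regionDensity μ C hu θ O]
  simp only [sum_regionDensity, integral_const, smul_eq_mul, mul_one, measureReal_def]

/-- **THE CORE OF A TERM IS THE COMMON REFINEMENT OF ITS SMALL SLOTS**: `A_{Ω₀} − sh_{Ω₀} =
∫ ∏_{s∈Ω₀} χ_θ(u^A_s)χ_θ(u^B_s) · ∏_{s∈C∖Ω₀} ζ_θ(u^A_s) dμ` (identical small-slot indicator products in both runs;
the large-field factors stay this run's own). [folklore] -/
theorem core_eq (C : Finset σ) (μ : Measure Ω) [IsFiniteMeasure μ] {uA uB : σ → Ω → ℝ}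
    (huA : ∀ s, Measurable (uA s)) (huB : ∀ s, Measurable (uB s)) (θ : ℝ) (O : Finset σ) :
    regionWeight C μ uA θ O - regionShell C μ uA uB θ O =
      ∫ ω, (∏ s ∈ O, smallInd (uA s ω) θ * smallInd (uB s ω) θ) * ∏ s ∈ C \ O, largeInd (uA s ω) θ ∂μ := by
  have hint : Integrable (fun ω => regionDensity C uA θ O ω * (1 - ∏ s ∈ O, smallInd (uB s ω) θ)) μ :=
    (integrable_regionDensity μ C huA θ O).mul_of_top_left
      (memLp_top_of_bound
        ((Finset.measurable_prod _ fun s _ => measurable_smallInd (huB s) θ).const_sub 1).aestronglyMeasurable 1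
        (Eventually.of_forall fun ω => by
          rw [Real.norm_eq_abs, abs_le]
          constructor <;> nlinarith [(prod_smallInd_mem O uB θ ω).1, (prod_smallInd_mem O uB θ ω).2]))
  unfold regionWeight regionShell
  rw [← integral_sub (integrable_regionDensity μ C huA θ O) hint]
  refine integral_congr_ae (Eventually.of_forall fun ω => ?_)
  simp only [regionDensity, Finset.prod_mul_distrib]
  ring

/-- **(R) `cover`**: `sh_{Ω₀} ≤ Σ_{s ∈ C} piece s Ω₀` for `Ω₀ ⊆ C` (the pieces vanish off `Ω₀`). [folklore] -/
theorem regionShell_le_sum_piece (C : Finset σ) (μ : Measure Ω) [IsFiniteMeasure μ] {uA uB : σ → Ω → ℝ}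
    (huA : ∀ s, Measurable (uA s)) (huB : ∀ s, Measurable (uB s)) (θ : ℝ) {O : Finset σ} (hO : O ⊆ C) :
    regionShell C μ uA uB θ O ≤ ∑ s ∈ C, regionPiece C μ uA uB θ s O := by
  have hint : ∀ s, Integrable (fun ω => regionDensity C uA θ O ω * (1 - smallInd (uB s ω) θ)) μ := fun s =>
    (integrable_regionDensity μ C huA θ O).mul_of_top_left
      (memLp_top_of_bound ((measurable_smallInd (huB s) θ).const_sub 1).aestronglyMeasurable 1
        (Eventually.of_forall fun ω => by
          rw [Real.norm_eq_abs, abs_le]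
          constructor <;> nlinarith [smallInd_nonneg (uB s ω) θ, smallInd_le_one (uB s ω) θ]))
  have hpiece : ∑ s ∈ C, regionPiece C μ uA uB θ s O =
      ∑ s ∈ O, ∫ ω, regionDensity C uA θ O ω * (1 - smallInd (uB s ω) θ) ∂μ := by
    unfold regionPiece
    rw [Finset.sum_ite_mem, Finset.inter_eq_right.2 hO]
  rw [hpiece, ← integral_finsetSum _ fun s _ => hint s]
  exact integral_mono_of_nonneg (Eventually.of_forall fun ω => mul_nonneg (regionDensity_nonneg C uA θ O ω)
    (sub_nonneg.2 (prod_smallInd_mem O uB θ ω).2)) (integrable_finsetSum _ fun s _ => hint s)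
    (Eventually.of_forall fun ω => regionDensity_mul_one_sub_prod_le C uA uB θ O ω)

/-- **THE PIECES OF ONE SLOT SUM TO ITS ONE-SLOT MISMATCH INTEGRAL**: for a cube `s ∈ C`,
`Σ_{Ω₀ ⊆ C} piece s Ω₀ = ∫ χ_θ(u^A_s)(1 − χ_θ(u^B_s)) dμ` (the other slots' partition of unity summed,
`sum_regionDensity_mem`). [folklore] -/
theorem sum_regionPiece_eq (C : Finset σ) (μ : Measure Ω) [IsFiniteMeasure μ] {uA uB : σ → Ω → ℝ}
    (huA : ∀ s, Measurable (uA s)) (huB : ∀ s, Measurable (uB s)) (θ : ℝ) {s : σ} (hs : s ∈ C) :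
    ∑ O ∈ C.powerset, regionPiece C μ uA uB θ s O = ∫ ω, smallInd (uA s ω) θ * (1 - smallInd (uB s ω) θ) ∂μ := by
  have hint : ∀ O, Integrable (fun ω => regionDensity C uA θ O ω * (1 - smallInd (uB s ω) θ)) μ := fun O =>
    (integrable_regionDensity μ C huA θ O).mul_of_top_left
      (memLp_top_of_bound ((measurable_smallInd (huB s) θ).const_sub 1).aestronglyMeasurable 1
        (Eventually.of_forall fun ω => by
          rw [Real.norm_eq_abs, abs_le]
          constructor <;> nlinarith [smallInd_nonneg (uB s ω) θ, smallInd_le_one (uB s ω) θ]))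
  have hpt : ∀ O ∈ C.powerset, regionPiece C μ uA uB θ s O =
      ∫ ω, (if s ∈ O then regionDensity C uA θ O ω else 0) * (1 - smallInd (uB s ω) θ) ∂μ := by
    intro O _
    unfold regionPiece
    split_ifs with h
    · rfl
    · simp
  rw [Finset.sum_congr rfl hpt, ← integral_finsetSum _ fun O _ => ?_]
  · refine integral_congr_ae (Eventually.of_forall fun ω => ?_)
    show ∑ O ∈ C.powerset, (if s ∈ O then regionDensity C uA θ O ω else 0) * (1 - smallInd (uB s ω) θ) = _
    rw [← Finset.sum_mul, sum_regionDensity_mem C uA θ hs ω]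
  · by_cases h : s ∈ O
    · simpa only [h, if_true] using hint O
    · simp only [h, if_false, zero_mul]
      exact integrable_zero _ _ _

/-- **THE [dict] PUSH FOR SLOT `s`**: under `ρθ`-closeness of the slot's two tested variables `μ`-a.e., its pieces
weigh at most the `μ`-mass of the run's OWN threshold shell of that slot: `Σ_{Ω₀} piece s Ω₀ ≤ 1 · μ{θ(1−ρ) ≤ u^A_s < θ}`
(road P2's `ShellMeasureWindowLiaison.integral_mismatch_le`, `Rm ≡ 1`). [folklore] -/
theorem sum_regionPiece_le (C : Finset σ) (μ : Measure Ω) [IsFiniteMeasure μ] {uA uB : σ → Ω → ℝ}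
    (huA : ∀ s, Measurable (uA s)) (huB : ∀ s, Measurable (uB s)) {θ ρ : ℝ} {s : σ} (hs : s ∈ C)
    (hclose : ∀ᵐ ω ∂μ, |uA s ω - uB s ω| ≤ ρ * θ) :
    ∑ O ∈ C.powerset, regionPiece C μ uA uB θ s O ≤
      1 * (μ {ω | θ * (1 - ρ) ≤ uA s ω ∧ uA s ω < θ}).toReal := by
  rw [sum_regionPiece_eq C μ huA huB θ hs]
  have h := integral_mismatch_le μ (huA s) (Rm := fun _ => (1 : ℝ)) (M := 1) hclose
    (Eventually.of_forall fun _ => zero_le_one) (Eventually.of_forall fun _ => le_rfl)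
  simpa only [mul_one] using h

end Objects

/-! ## §2 END-I's per-run binders, LITERALLY, for the `(K, t)`-indexed level-0 cube family -/

section Binders

variable {Ω : ℕ → Type*} [∀ K, MeasurableSpace (Ω K)] {σ : Type*} [DecidableEq σ] (C : ℕ → Finset σ)
  (μ : ∀ K : ℕ, ℝ → Measure (Ω K)) [∀ K t, IsFiniteMeasure (μ K t)] (uA uB : ∀ K : ℕ, ℝ → σ → Ω K → ℝ)
  (θ ρ : ℕ → ℝ) (l₀ : ℝ)

omit [∀ K t, IsFiniteMeasure (μ K t)] in
/-- (R) `sh_nonneg` in END-I's shape. [folklore] -/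
theorem sh_nonneg : ∀ K t, |t| ≤ l₀ → ∀ O ∈ (C K).powerset,
    0 ≤ regionShell (C K) (μ K t) (uA K t) (uB K t) (θ 0) O :=
  fun K t _ O _ => regionShell_nonneg (C K) (μ K t) (uA K t) (uB K t) (θ 0) O

/-- (R) `sh_le` in END-I's shape: the shell part of a term never exceeds the term. [folklore] -/
theorem sh_le (huA : ∀ K t s, Measurable (uA K t s)) : ∀ K t, |t| ≤ l₀ → ∀ O ∈ (C K).powerset,
    regionShell (C K) (μ K t) (uA K t) (uB K t) (θ 0) O ≤ regionWeight (C K) (μ K t) (uA K t) (θ 0) O :=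
  fun K t _ O _ => regionShell_le_regionWeight (C K) (μ K t) (huA K t) (uB K t) (θ 0) O

/-- (R) `cover` in END-I's shape: a term's shell part is covered by its per-slot pieces (union bound over its small
cubes). [folklore] -/
theorem cover (huA : ∀ K t s, Measurable (uA K t s)) (huB : ∀ K t s, Measurable (uB K t s)) :
    ∀ K t, |t| ≤ l₀ → ∀ O ∈ (C K).powerset,
      regionShell (C K) (μ K t) (uA K t) (uB K t) (θ 0) O ≤
        ∑ s ∈ C K, regionPiece (C K) (μ K t) (uA K t) (uB K t) (θ 0) s O :=
  fun K t _ _ hO => regionShell_le_sum_piece (C K) (μ K t) (huA K t) (huB K t) (θ 0) (Finset.mem_powerset.1 hO)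

omit [DecidableEq σ] [∀ K t, IsFiniteMeasure (μ K t)] in
/-- [dict] `hM` in END-I's shape: `M := 1 ≥ 0`. [folklore] -/
theorem M_nonneg : ∀ (K : ℕ) (t : ℝ), |t| ≤ l₀ → ∀ _s ∈ C K, (0 : ℝ) ≤ 1 :=
  fun _ _ _ _ _ => zero_le_one

/-- **[dict] PUSH `piece_le` in END-I's shape**, per cube `s ∈ C K`: under a.e. `ρ₀θ₀`-closeness of that cube's two
tested variables, its pieces weigh at most `1 ×` the realized mass of the run's OWN threshold shell
`{θ₀(1 − ρ₀) ≤ u^A_s < θ₀}`, the realized measure being `μ K t` itself. [folklore] -/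
theorem piece_le (huA : ∀ K t s, Measurable (uA K t s)) (huB : ∀ K t s, Measurable (uB K t s))
    (hclose : ∀ K t, |t| ≤ l₀ → ∀ s ∈ C K, ∀ᵐ ω ∂(μ K t), |uA K t s ω - uB K t s ω| ≤ ρ 0 * θ 0) :
    ∀ K t, |t| ≤ l₀ → ∀ s ∈ C K,
      ∑ O ∈ (C K).powerset, regionPiece (C K) (μ K t) (uA K t) (uB K t) (θ 0) s O ≤
        1 * ((μ K t) {x | θ 0 * (1 - ρ 0) ≤ uA K t s x ∧ uA K t s x < θ 0}).toReal :=
  fun K t ht s hs => sum_regionPiece_le (C K) (μ K t) (huA K t) (huB K t) hs (hclose K t ht s hs)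

/-- **[dict] PUSH `total_ge` in END-I's shape, WITH EQUALITY**: `1 × μ(univ) = Σ_{Ω₀} A_{Ω₀}`. [folklore] -/
theorem total_ge (huA : ∀ K t s, Measurable (uA K t s)) : ∀ K t, |t| ≤ l₀ → ∀ _s ∈ C K,
    1 * ((μ K t) Set.univ).toReal ≤ ∑ O ∈ (C K).powerset, regionWeight (C K) (μ K t) (uA K t) (θ 0) O :=
  fun K t _ _ _ => by rw [one_mul, sum_regionWeight_eq (C K) (μ K t) (huA K t) (θ 0)]

end Binders

/-! ## §3 The plug into END-I's one-run ledger: only (M1)₀ per slot stays displayed -/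

section Plug

variable {Ω : ℕ → Type*} [∀ K, MeasurableSpace (Ω K)] {σ : Type*} [DecidableEq σ] {C : ℕ → Finset σ}
  {μ : ∀ K : ℕ, ℝ → Measure (Ω K)} [∀ K t, IsFiniteMeasure (μ K t)] {uA uB : ∀ K : ℕ, ℝ → σ → Ω K → ℝ}
  {θ ρ D : ℕ → ℝ} {l₀ : ℝ}

/-- **LEVEL 0, FULL CUBE PARTITION: `LevelLedger` ⇐ (M1)₀ PER SLOT.**  Terms `Ω₀ ∈ (C K).powerset` with weights
`∫ regionDensity (C K) u^A θ₀ Ω₀ d(μ K t)`, shell parts `regionShell`, slots `C K` at level `0` with pieces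
`regionPiece`, realized measures `μ K t` for every slot, tested variables `u^A K t s`, `M = 1`: the six per-run binders
of `ShellMeasureRootComposition.levelLedger_of_slotAC` are THEOREMS (§2), so `T4ShellMeasureLevels.LevelLedger` follows
from measurability of both runs' tested variables, the a.e. closeness `|u^A_s − u^B_s| ≤ ρ₀θ₀` per cube, signs
`0 ≤ D, ρ`, and THE WALL (M1)₀ PER SLOT `hac`.  CONDITIONAL on `hac`; nothing printed asserted. [folklore] -/
theorem levelLedger_levelZero_cubes (huA : ∀ K t s, Measurable (uA K t s)) (huB : ∀ K t s, Measurable (uB K t s))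
    (hclose : ∀ K t, |t| ≤ l₀ → ∀ s ∈ C K, ∀ᵐ ω ∂(μ K t), |uA K t s ω - uB K t s ω| ≤ ρ 0 * θ 0)
    (hD : ∀ j, 0 ≤ D j) (hρ : ∀ j, 0 ≤ ρ j)
    (hac : ∀ K t, |t| ≤ l₀ → ∀ s ∈ C K, SlotAntiConcentration (μ K t) (uA K t s) (θ 0) (ρ 0) (D 0)) :
    LevelLedger l₀ (fun K => (C K).powerset) (fun K t => regionWeight (C K) (μ K t) (uA K t) (θ 0))
      (fun K t => regionShell (C K) (μ K t) (uA K t) (uB K t) (θ 0)) C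
      (fun K t => regionPiece (C K) (μ K t) (uA K t) (uB K t) (θ 0)) (fun _ _ => 0) D ρ :=
  levelLedger_of_slotAC (Ω := fun K _ => Ω K) (μ := fun K t _ => μ K t) (u := fun K t s => uA K t s) (θ := θ)
    (M := fun _ _ _ => (1 : ℝ))
    (sh_nonneg C μ uA uB θ l₀) (sh_le C μ uA uB θ l₀ huA) (cover C μ uA uB θ l₀ huA huB) (M_nonneg C l₀)
    (piece_le C μ uA uB θ ρ l₀ huA huB hclose) (total_ge C μ uA θ l₀ huA) hD hρ hac

/-- the relative shell weight this ledger books at cutoff `K` is the level-0 SLOT COUNT times one summand,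
`ω K = #(C K) · D₀ρ₀` — bounding `#(C K)` inside the live window is (W1)∕row S9's business, not this file's.
[folklore] -/
theorem omega_levelZero_cubes (huA : ∀ K t s, Measurable (uA K t s)) (huB : ∀ K t s, Measurable (uB K t s))
    (hclose : ∀ K t, |t| ≤ l₀ → ∀ s ∈ C K, ∀ᵐ ω ∂(μ K t), |uA K t s ω - uB K t s ω| ≤ ρ 0 * θ 0)
    (hD : ∀ j, 0 ≤ D j) (hρ : ∀ j, 0 ≤ ρ j)
    (hac : ∀ K t, |t| ≤ l₀ → ∀ s ∈ C K, SlotAntiConcentration (μ K t) (uA K t s) (θ 0) (ρ 0) (D 0)) (K : ℕ) :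
    (levelLedger_levelZero_cubes huA huB hclose hD hρ hac).toSlotLedger.omega K = (C K).card * (D 0 * ρ 0) :=
  (T4ShellMeasureLevels.LevelLedger.omega_eq (levelLedger_levelZero_cubes huA huB hclose hD hρ hac) K).trans
    (by rw [Finset.sum_const, nsmul_eq_mul])

end Plug

end Summit.QuantumFields.BalabanUV.T4Continuum.ShellMeasureRootCompositionPushCubes

end
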